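/-
Origin: expansion seat `planner-pub-hodgecm-pv10-0`, handover #6 2026-08-18T04:14:48Z (`HOME/pub-hodgecm-pv10/lean/Pv10/ProperImage.lean`, md5 cfdd4676, 153 lines);
landed by the gen-5 packager in gate run 21 as `HodgeCM/PerL34/ProperImage.lean` (verbatim).
-/
/-
Origin: planner-pub-hodgecm-pv10-0 (unit pub-hodgecm-pv10), HodgeCM publication cell, 2026-08-18.
Node N15 (PerL v5 §3.2, tex ll. 309–313): "B is closed, being the product of the closed subgroup
𝔸^×_{L₀}L^×/L^× (the image of the idele class group of L₀, which injects continuously and properly …)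
and the compact image of L^×_∞/L^×_{0,∞}; so the character extends" — the TOPOLOGICAL inference in
abstract form, KERNEL (Mathlib only).  This is the site of review R1's error E3 (v1: closedness of the
subgroup was asserted without argument; repaired in v2 by the properness argument typed here).
-/
import Mathlib.Topology.Maps.Proper.Basic
import Mathlib.Topology.Algebra.Group.Basic
import Mathlib.Algebra.Group.Subgroup.Lattice

/-!
# Proper image · compact image is closed, and characters on it (node N15, closedness of `B`)

Let `C` be a commutative topological group, `f : A →* C` a continuous homomorphism which is a PROPER map
(PerL: the idele class group of `L₀` "injects continuously and properly" into that of `L`) and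
`g : N →* C` a continuous homomorphism from a COMPACT group (PerL: the compact torus
`L_∞^×/L_{0,∞}^× ≅ (ℂ^×/ℝ^×)^{[L₀:ℚ]}`, or a compact torus in `L_∞^×` surjecting onto it).  Then

* `MonoidHom.isProperMap_coprod`: `(a, n) ↦ f a · g n : A × N → C` is a proper map;
* `MonoidHom.isClosed_range_sup_range`: `B := f.range ⊔ g.range` is CLOSED in `C` (tex l. 309);
* `MonoidHom.isQuotientMap_toSupRange`: `A × N → B` is a quotient map, hence
  `MonoidHom.continuous_on_sup_range_iff`: a map out of `B` (with the subspace topology of `C`) is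
  continuous iff its pullback to `A × N` is; in particular (`continuous_char_sup_range_iff`) a
  character `χ : B →* M` is continuous iff `a ↦ χ (f a)` and `n ↦ χ (g n)` are.

So the character `χ_B` glued from continuous data (`CharacterGluing`) is continuous on the closed
subgroup `B`, and extends (`HeckeCharExtensionCont`, which in fact needs neither closedness nor
Pontryagin duality).  Not typed here: the maps `C_{L₀} → C_L`, `L_∞^× → C_L` themselves for a CM
extension `L/L₀` (base change of adele rings is absent from Mathlib) and the properness of the former.
-/

set_option autoImplicit false

namespace MonoidHom

variable {A N C : Type*} [Group A] [Group N] [CommGroup C] (f : A →* C) (g : N →* C)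

/-! ### Algebra: the range of `f.coprod g` is `f.range ⊔ g.range` -/

/-- (Ported verbatim from the HodgeCMPerL package; no docstring in the source.) -/
theorem coprod_eq_comp :
    ⇑(f.coprod g) = (fun p : C × N => p.1 * g p.2) ∘ Prod.map f _root_.id := by
  ext p; rfl

/-- (Ported verbatim from the HodgeCMPerL package; no docstring in the source.) -/
theorem range_coprod_eq_sup : (f.coprod g).range = f.range ⊔ g.range := by
  ext c
  constructor
  · rintro ⟨p, rfl⟩
    rw [coprod_apply]
    exact mul_mem (Subgroup.mem_sup_left ⟨p.1, rfl⟩) (Subgroup.mem_sup_right ⟨p.2, rfl⟩)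
  · intro hc
    obtain ⟨y, ⟨a, rfl⟩, z, ⟨n, rfl⟩, rfl⟩ := Subgroup.mem_sup.mp hc
    exact ⟨(a, n), rfl⟩

/-- (Ported verbatim from the HodgeCMPerL package; no docstring in the source.) -/
theorem coe_range_coprod_eq :
    Set.range (f.coprod g) = ((f.range ⊔ g.range : Subgroup C) : Set C) := by
  rw [← range_coprod_eq_sup]; rfl

/-- The map `A × N → B = f.range ⊔ g.range`, `(a, n) ↦ f a · g n`. -/
def toSupRange : A × N → (f.range ⊔ g.range : Subgroup C) :=
  fun p => ⟨f p.1 * g p.2,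
    mul_mem (Subgroup.mem_sup_left ⟨p.1, rfl⟩) (Subgroup.mem_sup_right ⟨p.2, rfl⟩)⟩

/-- (Ported verbatim from the HodgeCMPerL package; no docstring in the source.) -/
@[simp] theorem coe_toSupRange (p : A × N) : (toSupRange f g p : C) = f p.1 * g p.2 := rfl

/-- (Ported verbatim from the HodgeCMPerL package; no docstring in the source.) -/
theorem toSupRange_surjective : Function.Surjective (toSupRange f g) := by
  rintro ⟨c, hc⟩
  obtain ⟨y, ⟨a, rfl⟩, z, ⟨n, rfl⟩, rfl⟩ := Subgroup.mem_sup.mp hc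
  exact ⟨(a, n), rfl⟩

/-- (Ported verbatim from the HodgeCMPerL package; no docstring in the source.) -/
theorem val_comp_toSupRange : Subtype.val ∘ toSupRange f g = ⇑(f.coprod g) := by
  ext p; rfl

/-! ### Topology -/

variable [TopologicalSpace A] [TopologicalSpace N] [TopologicalSpace C] [IsTopologicalGroup C]

/-- The shear `(c, n) ↦ (c · g n, n)` as a homeomorphism of `C × N`. -/
def shearHomeomorph (hg : Continuous g) : C × N ≃ₜ C × N where
  toFun p := (p.1 * g p.2, p.2)
  invFun p := (p.1 * (g p.2)⁻¹, p.2)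
  left_inv p := by simp
  right_inv p := by simp
  continuous_toFun := by fun_prop
  continuous_invFun := by fun_prop

/-- `(a, n) ↦ f a · g n` is proper when `f` is proper and `N` is compact. -/
theorem isProperMap_coprod [CompactSpace N] (hf : IsProperMap f) (hg : Continuous g) :
    IsProperMap (f.coprod g) := by
  have h1 : IsProperMap (Prod.map f (_root_.id : N → N)) := hf.prodMap isProperMap_id
  have h2 : IsProperMap (fun p : C × N => p.1 * g p.2) := by
    have : (fun p : C × N => p.1 * g p.2) = Prod.fst ∘ shearHomeomorph g hg := rfl
    rw [this]
    exact isProperMap_fst_of_compactSpace.comp (shearHomeomorph g hg).isProperMap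
  rw [coprod_eq_comp]
  exact h2.comp h1

/-- **PerL l. 309: `B` is closed** — the product of a proper image and a compact image. -/
theorem isClosed_range_sup_range [CompactSpace N] (hf : IsProperMap f) (hg : Continuous g) :
    IsClosed ((f.range ⊔ g.range : Subgroup C) : Set C) := by
  rw [← coe_range_coprod_eq]
  exact (isProperMap_coprod f g hf hg).isClosed_range

/-- (Ported verbatim from the HodgeCMPerL package; no docstring in the source.) -/
theorem continuous_toSupRange (hf : Continuous f) (hg : Continuous g) :
    Continuous (toSupRange f g) := by
  apply Continuous.subtype_mk
  fun_prop

/-- `A × N → B` is proper (so closed and a quotient map) when `f` is proper and `N` compact. -/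
theorem isProperMap_toSupRange [CompactSpace N] (hf : IsProperMap f) (hg : Continuous g) :
    IsProperMap (toSupRange f g) := by
  refine isProperMap_of_comp_of_inj (continuous_toSupRange f g hf.continuous hg)
    continuous_subtype_val ?_ Subtype.val_injective
  rw [val_comp_toSupRange]
  exact isProperMap_coprod f g hf hg

/-- **The topology of `B` is the quotient topology from `A × N`.** -/
theorem isQuotientMap_toSupRange [CompactSpace N] (hf : IsProperMap f) (hg : Continuous g) :
    Topology.IsQuotientMap (toSupRange f g) :=
  (isProperMap_toSupRange f g hf hg).isClosedMap.isQuotientMap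
    (continuous_toSupRange f g hf.continuous hg) (toSupRange_surjective f g)

/-- A map out of `B` (subspace topology of `C`) is continuous iff its pullback to `A × N` is. -/
theorem continuous_on_sup_range_iff [CompactSpace N] (hf : IsProperMap f) (hg : Continuous g)
    {Z : Type*} [TopologicalSpace Z] (φ : (f.range ⊔ g.range : Subgroup C) → Z) :
    Continuous φ ↔ Continuous (φ ∘ toSupRange f g) :=
  (isQuotientMap_toSupRange f g hf hg).continuous_iff

/-- **PerL ll. 309–313, continuity of `χ_B`.**  A character of `B = f.range ⊔ g.range` is continuous
iff its pullbacks along `f` and `g` are. -/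
theorem continuous_char_sup_range_iff [CompactSpace N] (hf : IsProperMap f) (hg : Continuous g)
    {M : Type*} [Monoid M] [TopologicalSpace M] [ContinuousMul M]
    (χ : (f.range ⊔ g.range : Subgroup C) →* M) :
    Continuous χ ↔
      Continuous (fun a : A => χ ⟨f a, Subgroup.mem_sup_left ⟨a, rfl⟩⟩) ∧
      Continuous (fun n : N => χ ⟨g n, Subgroup.mem_sup_right ⟨n, rfl⟩⟩) := by
  constructor
  · intro hχ
    constructor
    · exact hχ.comp (Continuous.subtype_mk (hf.continuous.comp continuous_id) _)
    · exact hχ.comp (Continuous.subtype_mk (hg.comp continuous_id) _)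
  · rintro ⟨h1, h2⟩
    rw [continuous_on_sup_range_iff f g hf hg]
    have : χ ∘ toSupRange f g = fun p : A × N =>
        χ ⟨f p.1, Subgroup.mem_sup_left ⟨p.1, rfl⟩⟩ * χ ⟨g p.2, Subgroup.mem_sup_right ⟨p.2, rfl⟩⟩ := by
      ext p
      rw [← map_mul]
      rfl
    rw [this]
    exact (h1.comp continuous_fst).mul (h2.comp continuous_snd)

end MonoidHom
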